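import Literature.Analysis.Convexity.UnitBallNetsVolumetric
import Literature.Probability.Moments.HoeffdingCounting
import Mathlib.Algebra.Order.Chebyshev
import Mathlib.Analysis.Complex.ExponentialBounds
import HarnessLib

/-!
# The norm of a random sign matrix: the `ε`-net bound, counting form

Topic `Probability/RandomMatrix`. A fully PROVED, measure-free rendering of the first bound on the
operator norm of a random matrix with independent bounded entries (Vershynin 2018, Thm. 4.4.5 /
Cor. 4.4.8, `‖A‖ ≲ √n` w.h.p., by the `ε`-net method: net of size `9ⁿ`, Hoeffding for the
bilinear form at fixed net points, union bound), in the generality needed for planted-clique and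
similar arguments: the entries are *signs read off a uniformly random bit vector through a
labelling*.

## Setting

* `x : ι → Bool` ranges over all bit vectors (counting measure = uniform probability);
* `lab : V → V → Option ι` says which bit (if any) drives the entry `(i, j)`; the only structural
  hypothesis is **pair-injectivity**: a bit drives at most the two entries `(i, j)` and `(j, i)`
  (`hinj`). Entries with `lab i j = none` are `0`, the others are `± 1` according to the bit
  (`h0`, `h1`); so symmetric sign matrices with any pattern of forced zeros (e.g. the centred
  adjacency matrix of `G(n, 1/2)` outside a planted block) are covered.
* The conclusion is about the bilinear form `Σᵢⱼ R(x)ᵢⱼ aᵢ bⱼ` on `EuclideanSpace ℝ V`, `m = #V`: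

  `#{x : ¬ ∀ a b, Σᵢⱼ R(x)ᵢⱼ aᵢ bⱼ ≤ 12 √m ‖a‖ ‖b‖} ≤ e^{-4m} · 2^{#ι}`
  (`card_filter_not_bilin_le_le`), i.e. `‖R(x)‖_op ≤ 12 √m` for all but an `e^{-4m}` fraction of
  the bit vectors.

## Proof (Vershynin 2018, proof of Thm. 4.4.5 with Hoeffding in place of the general sub-gaussian
bound)

Fix a `1/4`-net `N` of the unit ball with `#N ≤ 9^m` inside the ball
(`Literature.Analysis.Convexity.exists_net_unitBall_card_le`). For fixed `a, b` of norm `≤ 1` the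
form is `Σ_e ± C_e` with `C_e = Σ_{lab (i,j) = e} aᵢ bⱼ` and `Σ_e C_e² ≤ 2 ‖a‖² ‖b‖² ≤ 2` (each
fibre has `≤ 2` elements), so by Hoeffding (`Literature.Probability.Moments.hoeffding_count_pi`)
`#{x : 6√m ≤ form} ≤ e^{-36m/4} 2^{#ι} = e^{-9m} 2^{#ι}`. A union bound over `N × N` costs
`81^m ≤ e^{5m}`, and off the bad set the net lemma
(`Literature.Analysis.Convexity.bilin_le_of_net`) upgrades `< 6√m` on the net to
`≤ 12 √m ‖a‖ ‖b‖` everywhere.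

## References

* R. Vershynin, *High-Dimensional Probability*, CUP 2018, Thm. 4.4.5 and Cor. 4.4.8 (norm of
  matrices with independent sub-gaussian entries; symmetric case), proof of Thm. 4.4.5 (Steps 1–3)
  [Vershynin2018].
* W. Hoeffding, *Probability inequalities for sums of bounded random variables*, JASA 58 (1963),
  Thm. 2 [Hoeffding1963].
-/

noncomputable section

open Finset Real

namespace Literature.Probability.RandomMatrix

open Literature.Analysis.Convexity Literature.Probability.Moments

variable {ι : Type*} [Fintype ι] [DecidableEq ι] {V : Type*} [Fintype V] [DecidableEq V]

/-! ### The bilinear form of a labelled sign matrix at fixed vectors -/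

section Fixed

variable (lab : V → V → Option ι) (R : (ι → Bool) → V → V → ℝ)

omit [DecidableEq V] in
/-- The form `Σᵢⱼ R(x)ᵢⱼ aᵢ bⱼ` regrouped by driving bit: `Σ_e (±1) · C_e(a, b)` with
`C_e = Σ_{lab (i,j) = e} aᵢ bⱼ`. [cite: Vershynin2018, proof of Thm. 4.4.5 (Step 2)] -/
theorem sum_sum_eq_sum_sign_mul (h0 : ∀ x i j, lab i j = none → R x i j = 0)
    (h1 : ∀ x i j e, lab i j = some e → R x i j = if x e then 1 else -1)
    (x : ι → Bool) (a b : V → ℝ) :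
    ∑ i, ∑ j, R x i j * a i * b j =
      ∑ e, (if x e then (1 : ℝ) else -1) *
        ∑ p ∈ (univ : Finset (V × V)) with lab p.1 p.2 = some e, a p.1 * b p.2 := by
  classical
  rw [← Fintype.sum_prod_type']
  rw [← Finset.sum_fiberwise (univ : Finset (V × V)) (fun p => lab p.1 p.2)
    (fun p => R x p.1 p.2 * a p.1 * b p.2), Fintype.sum_option]
  have hnone : ∑ p ∈ (univ : Finset (V × V)) with lab p.1 p.2 = none,
      R x p.1 p.2 * a p.1 * b p.2 = 0 := by
    refine sum_eq_zero fun p hp => ?_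
    rw [h0 x p.1 p.2 (mem_filter.1 hp).2, zero_mul, zero_mul]
  rw [hnone, zero_add]
  refine sum_congr rfl fun e _ => ?_
  rw [mul_sum]
  refine sum_congr rfl fun p hp => ?_
  rw [h1 x p.1 p.2 e (mem_filter.1 hp).2, mul_assoc]

omit [Fintype ι] in
/-- Pair-injectivity bounds each fibre of the labelling by two elements. [folklore] -/
theorem card_filter_lab_eq_le_two
    (hinj : ∀ i j i' j' e, lab i j = some e → lab i' j' = some e →
      (i = i' ∧ j = j') ∨ (i = j' ∧ j = i')) (e : ι) :
    ((univ : Finset (V × V)).filter fun p => lab p.1 p.2 = some e).card ≤ 2 := by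
  classical
  set F := (univ : Finset (V × V)).filter fun p => lab p.1 p.2 = some e
  by_cases hF : F = ∅
  · rw [hF, card_empty]; exact Nat.zero_le 2
  obtain ⟨⟨i, j⟩, hij⟩ := Finset.nonempty_iff_ne_empty.2 hF
  have hij' : lab i j = some e := (mem_filter.1 hij).2
  calc F.card ≤ (insert (i, j) ({(j, i)} : Finset (V × V))).card := by
        refine card_le_card fun p hp => ?_
        have hp' : lab p.1 p.2 = some e := (mem_filter.1 hp).2
        rcases hinj p.1 p.2 i j e hp' hij' with ⟨h1', h2'⟩ | ⟨h1', h2'⟩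
        · rw [mem_insert]; exact Or.inl (Prod.ext h1' h2')
        · rw [mem_insert, mem_singleton]; exact Or.inr (Prod.ext h1' h2')
    _ ≤ 2 := (card_insert_le _ _).trans (by rw [card_singleton])

/-- The variance proxy: `Σ_e C_e(a,b)² ≤ 2 (Σ aᵢ²)(Σ bⱼ²)`.
[cite: Vershynin2018, proof of Thm. 4.4.5 (Step 2)] -/
theorem sum_sq_fibreSum_le
    (hinj : ∀ i j i' j' e, lab i j = some e → lab i' j' = some e →
      (i = i' ∧ j = j') ∨ (i = j' ∧ j = i')) (a b : V → ℝ) :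
    ∑ e, (∑ p ∈ (univ : Finset (V × V)) with lab p.1 p.2 = some e, a p.1 * b p.2) ^ 2 ≤
      2 * ((∑ i, a i ^ 2) * ∑ j, b j ^ 2) := by
  classical
  have hfib : ∀ e, (∑ p ∈ (univ : Finset (V × V)) with lab p.1 p.2 = some e, a p.1 * b p.2) ^ 2
      ≤ 2 * ∑ p ∈ (univ : Finset (V × V)) with lab p.1 p.2 = some e, (a p.1 * b p.2) ^ 2 := by
    intro e
    refine (sq_sum_le_card_mul_sum_sq (s := (univ : Finset (V × V)).filter
      fun p => lab p.1 p.2 = some e) (f := fun p => a p.1 * b p.2)).trans ?_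
    gcongr
    exact_mod_cast card_filter_lab_eq_le_two lab hinj e
  calc ∑ e, (∑ p ∈ (univ : Finset (V × V)) with lab p.1 p.2 = some e, a p.1 * b p.2) ^ 2
      ≤ ∑ e, 2 * ∑ p ∈ (univ : Finset (V × V)) with lab p.1 p.2 = some e, (a p.1 * b p.2) ^ 2 :=
        sum_le_sum fun e _ => hfib e
    _ = 2 * ∑ e, ∑ p ∈ (univ : Finset (V × V)) with lab p.1 p.2 = some e, (a p.1 * b p.2) ^ 2 := by
        rw [mul_sum]
    _ ≤ 2 * ∑ p : V × V, (a p.1 * b p.2) ^ 2 := by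
        gcongr
        rw [← Finset.sum_fiberwise (univ : Finset (V × V)) (fun p => lab p.1 p.2)
          (fun p => (a p.1 * b p.2) ^ 2), Fintype.sum_option]
        exact le_add_of_nonneg_left (sum_nonneg fun p _ => sq_nonneg _)
    _ = 2 * ((∑ i, a i ^ 2) * ∑ j, b j ^ 2) := by
        rw [Fintype.sum_prod_type, sum_mul_sum]
        refine congrArg _ (sum_congr rfl fun i _ => sum_congr rfl fun j _ => by ring)

/-- **Concentration at fixed vectors** (Hoeffding): for `Σ aᵢ² ≤ 1`, `Σ bⱼ² ≤ 1` and `m ≥ 1`,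
the bit vectors with `Σᵢⱼ R(x)ᵢⱼ aᵢ bⱼ ≥ 6 √m` number at most `e^{-9m} 2^{#ι}`.
[cite: Vershynin2018, proof of Thm. 4.4.5 (Step 2)] -/
theorem card_filter_le_form_le (h0 : ∀ x i j, lab i j = none → R x i j = 0)
    (h1 : ∀ x i j e, lab i j = some e → R x i j = if x e then 1 else -1)
    (hinj : ∀ i j i' j' e, lab i j = some e → lab i' j' = some e →
      (i = i' ∧ j = j') ∨ (i = j' ∧ j = i'))
    (a b : V → ℝ) (ha : ∑ i, a i ^ 2 ≤ 1) (hb : ∑ j, b j ^ 2 ≤ 1) {m : ℕ} (hm : 1 ≤ m) :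
    (((univ : Finset (ι → Bool)).filter fun x =>
        6 * Real.sqrt m ≤ ∑ i, ∑ j, R x i j * a i * b j).card : ℝ) ≤
      Real.exp (-(9 * m)) * 2 ^ Fintype.card ι := by
  classical
  -- the Hoeffding data
  set C : ι → ℝ := fun e => ∑ p ∈ (univ : Finset (V × V)) with lab p.1 p.2 = some e, a p.1 * b p.2
    with hC
  set f : ∀ _ : ι, Bool → ℝ := fun e bit => (if bit then (1 : ℝ) else -1) * C e with hf
  have hform : ∀ x : ι → Bool, ∑ i, ∑ j, R x i j * a i * b j = ∑ e, f e (x e) := fun x =>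
    sum_sum_eq_sum_sign_mul lab R h0 h1 x a b
  have hf0 : ∀ e, ∑ bit, f e bit = 0 := fun e => by simp [hf]
  have hfc : ∀ e bit, |f e bit| ≤ |C e| := fun e bit => by
    cases bit <;> simp [hf]
  have hS2 : ∑ e, |C e| ^ 2 ≤ 2 := by
    simp_rw [sq_abs]
    refine (sum_sq_fibreSum_le lab hinj a b).trans ?_
    calc 2 * ((∑ i, a i ^ 2) * ∑ j, b j ^ 2) ≤ 2 * (1 * 1) := by gcongr
      _ = 2 := by norm_num
  have hset : ((univ : Finset (ι → Bool)).filter fun x =>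
      6 * Real.sqrt m ≤ ∑ i, ∑ j, R x i j * a i * b j) =
      (univ : Finset (ι → Bool)).filter fun x => 6 * Real.sqrt m ≤ ∑ e, f e (x e) := by
    refine filter_congr fun x _ => ?_
    rw [hform x]
  rw [hset]
  rcases (sum_nonneg fun e (_ : e ∈ univ) => sq_nonneg |C e|).eq_or_lt with hS0 | hSpos
  · -- degenerate case: the form vanishes identically
    have hC0 : ∀ e, C e = 0 := fun e => by
      have := (sum_eq_zero_iff_of_nonneg fun e _ => sq_nonneg |C e|).1 hS0.symm e (mem_univ _)
      simpa using this
    have hempty : ((univ : Finset (ι → Bool)).filter fun x => 6 * Real.sqrt m ≤ ∑ e, f e (x e))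
        = ∅ := by
      refine filter_eq_empty_iff.2 fun x _ => not_le.2 ?_
      have : ∑ e, f e (x e) = 0 := sum_eq_zero fun e _ => by simp [hf, hC0 e]
      rw [this]
      have : (0 : ℝ) < Real.sqrt m := Real.sqrt_pos.2 (by exact_mod_cast hm)
      positivity
    rw [hempty, card_empty, Nat.cast_zero]
    positivity
  · have ht : (0 : ℝ) ≤ 6 * Real.sqrt m := by positivity
    have h := hoeffding_count_pi (κ := fun _ : ι => Bool) f (fun e => |C e|) hf0 hfc ht hSpos
    refine h.trans ?_
    have hprod : ∏ _e : ι, (Fintype.card Bool : ℝ) = 2 ^ Fintype.card ι := by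
      rw [prod_const, card_univ, Fintype.card_bool]; norm_num
    rw [hprod]
    gcongr
    -- `9m ≤ t²/(2S)` since `t² = 36 m` and `S ≤ 2`
    rw [le_div_iff₀ (by positivity), mul_pow, Real.sq_sqrt (Nat.cast_nonneg _)]
    nlinarith [hS2]

end Fixed

/-! ### The union bound over a net -/

/-- `81 ≤ e⁵`, the price of the union bound over a pair of `9^m`-nets. [folklore] -/
theorem eightyone_pow_mul_exp_le (m : ℕ) :
    (81 : ℝ) ^ m * Real.exp (-(9 * m)) ≤ Real.exp (-(4 * m)) := by
  have h81 : (81 : ℝ) ≤ Real.exp 5 := by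
    have h := Real.exp_one_gt_d9
    have h5 : Real.exp 5 = Real.exp 1 ^ 5 := by rw [← Real.exp_nat_mul]; norm_num
    rw [h5]
    have : (81 : ℝ) ≤ 2.7182818283 ^ 5 := by norm_num
    exact this.trans (pow_le_pow_left₀ (by norm_num) h.le 5)
  calc (81 : ℝ) ^ m * Real.exp (-(9 * m)) ≤ Real.exp 5 ^ m * Real.exp (-(9 * m)) := by
        gcongr
    _ = Real.exp (-(4 * m)) := by
        rw [← Real.exp_nat_mul, ← Real.exp_add]
        ring_nf

/-- **Norm of a random sign matrix, counting form** (Vershynin 2018, Thm. 4.4.5 / Cor. 4.4.8 for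
`±1` entries driven pair-injectively by uniform bits, any pattern of forced zeros): with `m = #V ≥ 1`,
all but at most `e^{-4m} · 2^{#ι}` bit vectors `x` satisfy
`Σᵢⱼ R(x)ᵢⱼ aᵢ bⱼ ≤ 12 √m ‖a‖ ‖b‖` for all `a, b ∈ ℝ^V`.
[cite: Vershynin2018, Thm. 4.4.5 and Cor. 4.4.8] -/
theorem card_filter_not_bilin_le_le (lab : V → V → Option ι)
    (hinj : ∀ i j i' j' e, lab i j = some e → lab i' j' = some e →
      (i = i' ∧ j = j') ∨ (i = j' ∧ j = i'))
    (R : (ι → Bool) → V → V → ℝ) (h0 : ∀ x i j, lab i j = none → R x i j = 0)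
    (h1 : ∀ x i j e, lab i j = some e → R x i j = if x e then 1 else -1)
    (hV : 1 ≤ Fintype.card V)
    [DecidablePred fun x : ι → Bool => ¬ ∀ a b : EuclideanSpace ℝ V,
      ∑ i, ∑ j, R x i j * a i * b j ≤ 12 * Real.sqrt (Fintype.card V) * ‖a‖ * ‖b‖] :
    (((univ : Finset (ι → Bool)).filter fun x => ¬ ∀ a b : EuclideanSpace ℝ V,
        ∑ i, ∑ j, R x i j * a i * b j ≤
          12 * Real.sqrt (Fintype.card V) * ‖a‖ * ‖b‖).card : ℝ) ≤
      Real.exp (-(4 * Fintype.card V)) * 2 ^ Fintype.card ι := by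
  classical
  set m := Fintype.card V with hm
  -- Step 1: the net
  obtain ⟨N, hN1, hNcard, hnet⟩ :=
    exists_net_unitBall_card_le (E := EuclideanSpace ℝ V) (ε := 1 / 4) (by norm_num)
  rw [finrank_euclideanSpace, ← hm] at hNcard
  have hN9 : (N.card : ℝ) ≤ 9 ^ m := by convert hNcard using 2; norm_num
  -- Step 2: the bad sets at net points
  let bad : EuclideanSpace ℝ V → EuclideanSpace ℝ V → Finset (ι → Bool) := fun a b =>
    (univ : Finset (ι → Bool)).filter fun x => 6 * Real.sqrt m ≤ ∑ i, ∑ j, R x i j * a i * b j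
  have hbad : ∀ a ∈ N, ∀ b ∈ N, ((bad a b).card : ℝ) ≤ Real.exp (-(9 * m)) * 2 ^ Fintype.card ι := by
    intro a ha b hb
    have ha1 : ∑ i, a i ^ 2 ≤ 1 := by
      rw [← EuclideanSpace.real_norm_sq_eq]
      exact pow_le_one₀ (norm_nonneg _) (hN1 a ha)
    have hb1 : ∑ j, b j ^ 2 ≤ 1 := by
      rw [← EuclideanSpace.real_norm_sq_eq]
      exact pow_le_one₀ (norm_nonneg _) (hN1 b hb)
    exact card_filter_le_form_le lab R h0 h1 hinj a b ha1 hb1 hV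
  -- Step 3: union bound
  set Bad := N.biUnion fun a => N.biUnion fun b => bad a b with hBad
  have hBadcard : (Bad.card : ℝ) ≤ Real.exp (-(4 * m)) * 2 ^ Fintype.card ι := by
    calc (Bad.card : ℝ) ≤ ∑ a ∈ N, ((N.biUnion fun b => bad a b).card : ℝ) := by
          exact_mod_cast card_biUnion_le
      _ ≤ ∑ a ∈ N, ∑ b ∈ N, ((bad a b).card : ℝ) := by
          refine sum_le_sum fun a _ => ?_
          exact_mod_cast card_biUnion_le
      _ ≤ ∑ a ∈ N, ∑ b ∈ N, Real.exp (-(9 * m)) * 2 ^ Fintype.card ι :=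
          sum_le_sum fun a ha => sum_le_sum fun b hb => hbad a ha b hb
      _ = N.card * (N.card * (Real.exp (-(9 * m)) * 2 ^ Fintype.card ι)) := by
          rw [sum_const, nsmul_eq_mul, sum_const, nsmul_eq_mul]
      _ ≤ 9 ^ m * (9 ^ m * (Real.exp (-(9 * m)) * 2 ^ Fintype.card ι)) := by gcongr
      _ = (81 ^ m * Real.exp (-(9 * m))) * 2 ^ Fintype.card ι := by
          rw [show (81 : ℝ) = 9 * 9 by norm_num, mul_pow]; ring
      _ ≤ Real.exp (-(4 * m)) * 2 ^ Fintype.card ι := by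
          gcongr; exact eightyone_pow_mul_exp_le m
  -- Step 4: off the bad set, the net lemma gives the bound everywhere
  have key : ∀ x : ι → Bool, x ∉ Bad → ∀ a b : EuclideanSpace ℝ V,
      ∑ i, ∑ j, R x i j * a i * b j ≤ 12 * Real.sqrt (Fintype.card V) * ‖a‖ * ‖b‖ := by
    intro x hxBad
    -- the bilinear form of `R x`
    let β : EuclideanSpace ℝ V →ₗ[ℝ] EuclideanSpace ℝ V →ₗ[ℝ] ℝ :=
      LinearMap.mk₂ ℝ (fun a b => ∑ i, ∑ j, R x i j * a i * b j)
        (fun a a' b => by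
          simp only [PiLp.add_apply, mul_add, add_mul, sum_add_distrib])
        (fun c a b => by
          simp only [PiLp.smul_apply, smul_eq_mul, mul_sum]
          refine sum_congr rfl fun i _ => sum_congr rfl fun j _ => by ring)
        (fun a b b' => by
          simp only [PiLp.add_apply, mul_add, sum_add_distrib])
        (fun c a b => by
          simp only [PiLp.smul_apply, smul_eq_mul, mul_sum]
          refine sum_congr rfl fun i _ => sum_congr rfl fun j _ => by ring)
    have hβ : ∀ a b : EuclideanSpace ℝ V, β a b = ∑ i, ∑ j, R x i j * a i * b j := fun a b => rfl
    have hcont : Continuous fun p : EuclideanSpace ℝ V × EuclideanSpace ℝ V => β p.1 p.2 := by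
      simp only [hβ]
      fun_prop
    have hnet' : ∀ y : EuclideanSpace ℝ V, ‖y‖ ≤ 1 → ∃ a ∈ N, ‖y - a‖ ≤ 1 / 4 := fun y hy => by
      obtain ⟨a, ha, hya⟩ := hnet y hy
      exact ⟨a, ha, hya.le⟩
    have hτ : ∀ a ∈ N, ∀ b ∈ N, β a b ≤ 6 * Real.sqrt m := by
      intro a ha b hb
      rw [hβ]
      by_contra hlt
      apply hxBad
      rw [hBad, mem_biUnion]
      refine ⟨a, ha, mem_biUnion.2 ⟨b, hb, ?_⟩⟩
      exact mem_filter.2 ⟨mem_univ _, (not_le.1 hlt).le⟩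
    intro a b
    have h := bilin_le_of_net β hcont hN1 hnet' hτ a b
    rw [hβ] at h
    rw [← hm]
    calc ∑ i, ∑ j, R x i j * a i * b j ≤ 2 * (6 * Real.sqrt m) * ‖a‖ * ‖b‖ := h
      _ = 12 * Real.sqrt m * ‖a‖ * ‖b‖ := by ring
  refine le_trans ?_ hBadcard
  have hsub : ((univ : Finset (ι → Bool)).filter fun x => ¬ ∀ a b : EuclideanSpace ℝ V,
      ∑ i, ∑ j, R x i j * a i * b j ≤ 12 * Real.sqrt (Fintype.card V) * ‖a‖ * ‖b‖) ⊆ Bad := by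
    intro x hx
    rw [mem_filter] at hx
    by_contra hxBad
    exact hx.2 (key x hxBad)
  exact_mod_cast card_le_card hsub

end Literature.Probability.RandomMatrix

end
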